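import Mathlib
import Literature.NumberTheory.Sieve.ParityBarrier
import HarnessLib

/-!
# Route ParityLeakOneFifth, crux `PlainSplit` (stmt-Parity-18382), skeleton `calib-split`:
# tools for stub `stub_roughLiouvilleTwistedSmall`, II — the remainder classes

The remainder of the signed interval sieve for `S_d` is a sum over moduli `e ∣ P(w)`, `e ≤ L`, and
admissible classes `c mod e` of `|Σ_{k ∈ (K₀,K₁], k ≡ c' (e)} λ(k)|`, `c' = K₀ + c`.  Writing
`g = (c', e)`, `e = g e'`, `c' = g u`: the class is `k = g k'` with `k' ≡ u (e')`, `(u, e') = 1`, so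
`|Σ| ≤ |Σ_{k' ≤ K₁/g, k' ≡ u (e')} λ| + |Σ_{k' ≤ K₀/g, k' ≡ u (e')} λ|` (`classSum_le`), a pair of
Bombieri–Vinogradov terms; and `g` determines the admissible class (`adm_class_unique`), since
every prime of `e` offers the class `0` and at most one other class.
-/

namespace Summit.Parity.GeneralizedHardyLittlewood.Theorems.ParityLeakOneFifth

open Finset

/-- `λ(mn) = λ(m)λ(n)` for `m, n ≠ 0`. -/
theorem liouville_mul' {m n : ℕ} (hm : m ≠ 0) (hn : n ≠ 0) :
    (ArithmeticFunction.liouville (m * n) : ℝ) =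
      (ArithmeticFunction.liouville m : ℝ) * ArithmeticFunction.liouville n := by
  rw [ArithmeticFunction.liouville_apply (mul_ne_zero hm hn), ArithmeticFunction.liouville_apply hm,
    ArithmeticFunction.liouville_apply hn, ArithmeticFunction.cardFactors_mul hm hn, pow_add]
  push_cast; ring

/-- Shift of a class sum: `Σ_{r ∈ [1,X], r ≡ c (e)} f(K₀ + r) = Σ_{k ∈ (K₀, K₀+X], k ≡ K₀ + c (e)} f(k)`
(`c < e`). -/
theorem sum_filter_mod_shift (K₀ X : ℕ) {e c : ℕ} (hc : c < e) (f : ℕ → ℝ) :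
    ∑ r ∈ (Finset.Icc 1 X).filter (fun r : ℕ => r % e = c), f (K₀ + r) =
      ∑ k ∈ (Finset.Ioc K₀ (K₀ + X)).filter (fun k : ℕ => k % e = (K₀ + c) % e), f k := by
  have hI : Finset.Ioc K₀ (K₀ + X) = (Finset.Icc 1 X).map (addLeftEmbedding K₀) := by
    rw [Finset.map_add_left_Icc, Finset.Icc_add_one_left_eq_Ioc]
  rw [hI, Finset.filter_map, Finset.sum_map]
  refine Finset.sum_congr ?_ fun r _ => rfl
  apply Finset.filter_congr
  intro r _
  simp only [Function.comp_apply, addLeftEmbedding_apply]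
  rw [← Nat.mod_eq_of_lt hc, ← ZMod.natCast_eq_natCast_iff', Nat.mod_eq_of_lt hc,
    ← ZMod.natCast_eq_natCast_iff']
  push_cast
  constructor
  · intro h; rw [h]
  · intro h; exact add_left_cancel h

/-- Scaling a class by a common factor: `k ≡ g u (mod g e')` on `(K₀, K₁]` iff `k = g k'` with
`k' ≡ u (mod e')` on `(K₀/g, K₁/g]`. -/
theorem sum_filter_mod_mul (K₀ K₁ : ℕ) {g : ℕ} (e' u : ℕ) (hg : 0 < g) (f : ℕ → ℝ) :
    ∑ k ∈ (Finset.Ioc K₀ K₁).filter (fun k : ℕ => k % (g * e') = g * u), f k =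
      ∑ k' ∈ (Finset.Ioc (K₀ / g) (K₁ / g)).filter (fun k' : ℕ => k' % e' = u), f (g * k') := by
  have key : ∀ k' : ℕ, (g * k') % (g * e') = g * (k' % e') := fun k' => Nat.mul_mod_mul_left g k' e'
  refine Finset.sum_nbij' (fun k => k / g) (fun k' => g * k') ?_ ?_ ?_ ?_ ?_
  · intro k hk
    rw [Finset.mem_filter, Finset.mem_Ioc] at hk
    obtain ⟨⟨h1, h2⟩, hmod⟩ := hk
    have hgk : g ∣ k := by
      rw [← Nat.div_add_mod k (g * e'), hmod]
      exact dvd_add (dvd_mul_of_dvd_left (dvd_mul_right g e') _) (dvd_mul_right g u)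
    obtain ⟨k', rfl⟩ := hgk
    rw [Finset.mem_filter, Finset.mem_Ioc, Nat.mul_div_cancel_left k' hg]
    refine ⟨⟨?_, ?_⟩, ?_⟩
    · have := Nat.div_lt_div_of_lt_of_dvd (dvd_mul_right g k') h1
      rwa [Nat.mul_div_cancel_left k' hg] at this
    · have := Nat.div_le_div_right (c := g) h2
      rwa [Nat.mul_div_cancel_left k' hg] at this
    · rw [key] at hmod
      exact Nat.eq_of_mul_eq_mul_left hg hmod
  · intro k' hk'
    rw [Finset.mem_filter, Finset.mem_Ioc] at hk'
    obtain ⟨⟨h1, h2⟩, hmod⟩ := hk'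
    rw [Finset.mem_filter, Finset.mem_Ioc, key, hmod]
    refine ⟨⟨?_, ?_⟩, rfl⟩
    · have := (Nat.div_lt_iff_lt_mul hg).1 h1; rw [mul_comm] at this; exact this
    · have := (Nat.le_div_iff_mul_le hg).1 h2; rw [mul_comm] at this; exact this
  · intro k hk
    rw [Finset.mem_filter] at hk
    have hgk : g ∣ k := by
      rw [← Nat.div_add_mod k (g * e'), hk.2]
      exact dvd_add (dvd_mul_of_dvd_left (dvd_mul_right g e') _) (dvd_mul_right g u)
    exact Nat.mul_div_cancel' hgk
  · intro k' _
    exact Nat.mul_div_cancel_left k' hg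
  · intro k hk
    rw [Finset.mem_filter] at hk
    have hgk : g ∣ k := by
      rw [← Nat.div_add_mod k (g * e'), hk.2]
      exact dvd_add (dvd_mul_of_dvd_left (dvd_mul_right g e') _) (dvd_mul_right g u)
    rw [Nat.mul_div_cancel' hgk]

/-- A window as a difference of two initial segments. -/
theorem sum_Ioc_filter_eq_sub {A B : ℕ} (hAB : A ≤ B) (P : ℕ → Prop) [DecidablePred P]
    (f : ℕ → ℝ) :
    ∑ k ∈ (Finset.Ioc A B).filter P, f k =
      ∑ k ∈ (Finset.Icc 1 B).filter P, f k - ∑ k ∈ (Finset.Icc 1 A).filter P, f k := by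
  have h1 : Finset.Icc 1 B = Finset.Icc 1 A ∪ Finset.Ioc A B := by
    ext k; simp only [Finset.mem_union, Finset.mem_Icc, Finset.mem_Ioc]; omega
  have h2 : Disjoint (Finset.Icc 1 A) (Finset.Ioc A B) := by
    rw [Finset.disjoint_left]; intro k hk hk'
    rw [Finset.mem_Icc] at hk; rw [Finset.mem_Ioc] at hk'; omega
  rw [h1, Finset.filter_union, Finset.sum_union (Finset.disjoint_filter_filter h2)]
  ring

/-- `k mod q = u` iff `k ≡ u` in `ZMod q` (`u < q`). -/
theorem mod_eq_iff_natCast_eq {q u : ℕ} (hu : u < q) (k : ℕ) :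
    k % q = u ↔ (k : ZMod q) = (u : ZMod q) := by
  haveI : NeZero q := ⟨by omega⟩
  rw [ZMod.natCast_eq_natCast_iff', Nat.mod_eq_of_lt hu]

/-- **Reduction of one remainder class to Bombieri–Vinogradov shape.**  For `0 < e`, `c < e`,
`K₀ ≤ K₁`, with `c' = (K₀ + c) mod e`, `g = (c', e)`, `e' = e/g`, `u = c'/g`:
`|Σ_{r ∈ [1, K₁−K₀], r ≡ c (e)} λ(K₀ + r)| ≤ |Σ_{m ≤ K₁/g, m ≡ u (e')} λ(m)| + |Σ_{m ≤ K₀/g, m ≡ u (e')} λ(m)|`,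
and `u < e'` is prime to `e'`. -/
theorem classSum_le {e c K₀ K₁ : ℕ} (he : 0 < e) (hc : c < e) (hK : K₀ ≤ K₁) :
    (K₀ + c) % e / Nat.gcd ((K₀ + c) % e) e < e / Nat.gcd ((K₀ + c) % e) e ∧
    Nat.Coprime ((K₀ + c) % e / Nat.gcd ((K₀ + c) % e) e) (e / Nat.gcd ((K₀ + c) % e) e) ∧
    |∑ r ∈ (Finset.Icc 1 (K₁ - K₀)).filter (fun r : ℕ => r % e = c),
        (ArithmeticFunction.liouville (K₀ + r) : ℝ)| ≤
      |∑ m ∈ (Finset.Icc 1 (K₁ / Nat.gcd ((K₀ + c) % e) e)).filter (fun m : ℕ =>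
          (m : ZMod (e / Nat.gcd ((K₀ + c) % e) e)) =
            (((K₀ + c) % e / Nat.gcd ((K₀ + c) % e) e : ℕ) : ZMod (e / Nat.gcd ((K₀ + c) % e) e))),
          (ArithmeticFunction.liouville m : ℝ)| +
      |∑ m ∈ (Finset.Icc 1 (K₀ / Nat.gcd ((K₀ + c) % e) e)).filter (fun m : ℕ =>
          (m : ZMod (e / Nat.gcd ((K₀ + c) % e) e)) =
            (((K₀ + c) % e / Nat.gcd ((K₀ + c) % e) e : ℕ) : ZMod (e / Nat.gcd ((K₀ + c) % e) e))),
          (ArithmeticFunction.liouville m : ℝ)| := by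
  set c' := (K₀ + c) % e with hc'
  set g := Nat.gcd c' e with hgdef
  have hc'e : c' < e := Nat.mod_lt _ he
  have hg0 : 0 < g := Nat.gcd_pos_of_pos_right _ he
  have hge : g ∣ e := Nat.gcd_dvd_right _ _
  have hgc : g ∣ c' := Nat.gcd_dvd_left _ _
  set e' := e / g with he'
  set u := c' / g with hu
  have hee : e = g * e' := (Nat.mul_div_cancel' hge).symm
  have hcc : c' = g * u := (Nat.mul_div_cancel' hgc).symm
  have he'0 : 0 < e' := Nat.div_pos (Nat.le_of_dvd he hge) hg0
  have hue : u < e' := by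
    rw [hu, he']
    by_contra h; push Not at h
    have : g * (e / g) ≤ g * (c' / g) := Nat.mul_le_mul_left g h
    rw [← hee, ← hcc] at this
    omega
  refine ⟨hue, ?_, ?_⟩
  · rw [hu, he', hgdef]; exact Nat.coprime_div_gcd_div_gcd hg0
  -- the class sum on `k = K₀ + r`
  rw [sum_filter_mod_shift K₀ (K₁ - K₀) hc (fun n => (ArithmeticFunction.liouville n : ℝ)),
    Nat.add_sub_cancel' hK, ← hc']
  conv_lhs => rw [hee, hcc]
  rw [sum_filter_mod_mul K₀ K₁ e' u hg0]
  -- `λ(g k') = λ(g) λ(k')`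
  have hmul : ∑ k' ∈ (Finset.Ioc (K₀ / g) (K₁ / g)).filter (fun k' : ℕ => k' % e' = u),
      (ArithmeticFunction.liouville (g * k') : ℝ) =
      (ArithmeticFunction.liouville g : ℝ) * ∑ k' ∈ (Finset.Ioc (K₀ / g) (K₁ / g)).filter
        (fun k' : ℕ => k' % e' = u), (ArithmeticFunction.liouville k' : ℝ) := by
    rw [Finset.mul_sum]
    refine Finset.sum_congr rfl fun k' hk' => ?_
    rw [Finset.mem_filter, Finset.mem_Ioc] at hk'
    exact liouville_mul' hg0.ne' (pos_of_gt hk'.1.1).ne'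
  rw [hmul, abs_mul]
  have hlg := Literature.NumberTheory.Sieve.abs_liouville_le_one g
  have hsplit := sum_Ioc_filter_eq_sub (Nat.div_le_div_right (c := g) hK)
    (fun k' : ℕ => k' % e' = u) (fun k' => (ArithmeticFunction.liouville k' : ℝ))
  have hcls : ∀ N : ℕ, ∑ k ∈ (Finset.Icc 1 N).filter (fun k' : ℕ => k' % e' = u),
      (ArithmeticFunction.liouville k : ℝ) =
      ∑ m ∈ (Finset.Icc 1 N).filter (fun m : ℕ => (m : ZMod e') = (u : ZMod e')),
        (ArithmeticFunction.liouville m : ℝ) := by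
    intro N
    refine Finset.sum_congr (Finset.filter_congr fun m _ => mod_eq_iff_natCast_eq hue m) fun _ _ => rfl
  rw [hsplit, hcls, hcls]
  calc _ ≤ 1 * |∑ m ∈ (Finset.Icc 1 (K₁ / g)).filter (fun m : ℕ => (m : ZMod e') = (u : ZMod e')),
          (ArithmeticFunction.liouville m : ℝ) -
        ∑ m ∈ (Finset.Icc 1 (K₀ / g)).filter (fun m : ℕ => (m : ZMod e') = (u : ZMod e')),
          (ArithmeticFunction.liouville m : ℝ)| := mul_le_mul_of_nonneg_right hlg (abs_nonneg _)
    _ ≤ _ := by rw [one_mul]; exact abs_sub _ _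

/-- **The admissible class is determined by its common divisor with the modulus.**  If every
prime `q ∣ e` (`e` squarefree) offers only the classes `0` and `t q` for `K₀ + c (mod q)`, then two
admissible `c₁, c₂ < e` with `(K₀ + c₁ mod e, e) = (K₀ + c₂ mod e, e)` coincide. -/
theorem adm_class_unique {e K₀ : ℕ} (he : Squarefree e) (Kc : ℕ → Finset ℕ) (t : ℕ → ℕ)
    (hKc : ∀ q ∈ e.primeFactors, ∀ v ∈ Kc q, v = 0 ∨ v = t q) {c₁ c₂ : ℕ} (hc₁ : c₁ < e)
    (hc₂ : c₂ < e) (h₁ : ∀ q ∈ e.primeFactors, (K₀ + c₁) % q ∈ Kc q)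
    (h₂ : ∀ q ∈ e.primeFactors, (K₀ + c₂) % q ∈ Kc q)
    (hg : Nat.gcd ((K₀ + c₁) % e) e = Nat.gcd ((K₀ + c₂) % e) e) : c₁ = c₂ := by
  have he0 : e ≠ 0 := he.ne_zero
  set a := (K₀ + c₁) % e with ha
  set b := (K₀ + c₂) % e with hb
  -- every prime of `e` sees the same residue
  have hq : ∀ q ∈ e.primeFactors, a % q = b % q := by
    intro q hqe
    have hqq := Nat.prime_of_mem_primeFactors hqe
    have hqd := Nat.dvd_of_mem_primeFactors hqe
    have haq : a % q = (K₀ + c₁) % q := Nat.mod_mod_of_dvd _ hqd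
    have hbq : b % q = (K₀ + c₂) % q := Nat.mod_mod_of_dvd _ hqd
    have hdiv : ∀ x : ℕ, x % q = 0 ↔ q ∣ Nat.gcd (x % e) e := by
      intro x
      rw [Nat.dvd_gcd_iff, and_iff_left hqd, Nat.dvd_iff_mod_eq_zero, Nat.mod_mod_of_dvd _ hqd]
    by_cases h0 : (K₀ + c₁) % q = 0
    · have : (K₀ + c₂) % q = 0 := by rw [hdiv] at h0 ⊢; rwa [← hg]
      rw [haq, hbq, h0, this]
    · have h0' : (K₀ + c₂) % q ≠ 0 := by
        intro h; rw [hdiv] at h; rw [← hg, ← hdiv] at h; exact h0 h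
      rcases hKc q hqe _ (h₁ q hqe) with h | h
      · exact absurd h h0
      rcases hKc q hqe _ (h₂ q hqe) with h' | h'
      · exact absurd h' h0'
      rw [haq, hbq, h, h']
  -- hence `a = b`
  have hab : a = b := by
    have hae : a < e := Nat.mod_lt _ (Nat.pos_of_ne_zero he0)
    have hbe : b < e := Nat.mod_lt _ (Nat.pos_of_ne_zero he0)
    have key : ∀ a b : ℕ, a < e → b < e → a ≤ b → (∀ q ∈ e.primeFactors, a % q = b % q) → a = b := by
      intro a b hae hbe hle hq
      have hdvd : ∀ q ∈ e.primeFactors, q ∣ b - a := fun q hqe =>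
        (Nat.modEq_iff_dvd' hle).1 (hq q hqe)
      have hprod : (∏ q ∈ e.primeFactors, q) ∣ b - a :=
        Finset.prod_primes_dvd _ (fun q hq => (Nat.prime_of_mem_primeFactors hq).prime) hdvd
      rw [Nat.prod_primeFactors_of_squarefree he] at hprod
      have : b - a < e := by omega
      have := Nat.eq_zero_of_dvd_of_lt hprod this
      omega
    rcases le_total a b with hle | hle
    · exact key a b hae hbe hle hq
    · exact (key b a hbe hae hle fun q hqe => (hq q hqe).symm).symm
  -- and `c₁ = c₂`
  have h := Nat.ModEq.add_left_cancel' K₀ (show (K₀ + c₁) % e = (K₀ + c₂) % e from hab)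
  rw [Nat.ModEq, Nat.mod_eq_of_lt hc₁, Nat.mod_eq_of_lt hc₂] at h
  exact h

end Summit.Parity.GeneralizedHardyLittlewood.Theorems.ParityLeakOneFifth
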